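import Summits.CriticalPhenomena.Ising3DConformalLimit.Theorems.EnergyNotSigmaSquaredGapForcesFarMergingRPSchwarzDefs
import Summits.CriticalPhenomena.Ising3DConformalLimit.Theorems.EnergyNotSigmaSquaredGapForcesFarMergingRpUnpinch
import Literature.Probability.LatticeModels.FreeBoundaryReflectionPositivity
import Literature.Probability.LatticeModels.CriticalCorrWellDefined
import Literature.Probability.LatticeModels.GKSInequalities
import HarnessLib

/-!
# Stub A of the line `rp-schwarz-single-pinch`: the RP Gram minor across every lattice mirror
(crux `GapForcesFarMerging`, item stmt-CriticalPhenomena-4468, route `EnergyNotSigmaSquared`;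
registered stub `stub_rpSchwarzOnePinch : RPSchwarzOnePinch`)

For the critical nearest-neighbour Ising state on `ℤ³` and the mirror
`θ_t = axisRefl 0 t : y ↦ (t - y₀, y₁, y₂)` (`t : ℕ`; the plane `{y₀ = t/2}` is a SITE plane for
even `t` and a BOND plane for odd `t`), the energy row `F = σ₀σ_{e₂} - ⟨σ₀σ_{e₂}⟩` and a pair row
`G = σ_pσ_q - ⟨σ_pσ_q⟩` with `2p₀ ≤ t`, `2q₀ ≤ t` both live in the half `{2y₀ ≤ t}`, and reflection
positivity of the state (Fröhlich–Israel–Lieb–Simon 1978, Thm. 2.1) says that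
`B(X, Y) := ⟨(X ∘ θ_t*) · Y⟩` is positive semidefinite on such observables; its `2 × 2` Gram
(Cauchy–Schwarz) minor `B(F,G)² ≤ B(F,F) · B(G,G)` is, by the lattice symmetries of the critical
state, the inequality `RPSchwarzOnePinch` between three truncated pair–pair correlations.

Proof (all ingredients are tree theorems; same architecture as the site-plane file
`…RpUnpinch.lean`, but along `θ_t`-symmetric volumes so that every mirror is covered at once).
* Finite volume: the free Gibbs measure of the `θ_t`-symmetrised box `Λ(L) ∪ θ_tΛ(L)` (`symBox`) is
  reflection positive across `θ_t` — through sites for even `t`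
  (`isingExpect_free_reflect_mul_self_nonneg`), through bonds for odd `t`
  (`isingExpect_free_reflect_mul_self_nonneg_of_cross`, ferromagnetic `β_c ≥ 0`), half `{2y₀ ≤ t}`.
* The free spin correlations are nondecreasing in the volume (GKS II, `isingCorr_free_le_of_subset`),
  so along the symmetrised boxes, sandwiched between `Λ(L)` and `Λ(L + t)`, the expectations of spin
  monomials converge to the critical correlators (`criticalCorr_wellDefined_holds`, free b.c.).
* Hence the RP quadratic form `s ↦ lim ⟨(F_s ∘ θ_t*) F_s⟩`, `F_s = F + sG`, is a nonnegative quadratic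
  polynomial; `discrim_le_zero` gives the Gram inequality, and reflection invariance of the critical
  correlators (`cc4_axisRefl`, `cc2_axisRefl`) puts it in the registered form.

References: J. Fröhlich, R. Israel, E. H. Lieb, B. Simon, Comm. Math. Phys. 62 (1978) 1–34, §2,
Thm. 2.1 [FILS1978]; S. Friedli, Y. Velenik, *Statistical Mechanics of Lattice Systems* (CUP 2017),
Lemma 10.8, Exercise 3.12 [FriedliVelenik2017].
-/

noncomputable section

namespace Summit.CriticalPhenomena.Ising3DConformalLimit.GapForcesFarMergingRPSchwarz

open MeasureTheory Filter
open scoped Topology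
open Literature.Probability.LatticeModels
open Summit.CriticalPhenomena.Ising3DConformalLimit.Theses.EnergyNotSigmaSquared
open Summit.CriticalPhenomena.Ising3DConformalLimit.Theorems.GapForcesFarMerging.Negative (e₁ e₂ cc2)
open Summit.CriticalPhenomena.Ising3DConformalLimit.EnergyNotSigmaSquaredGapForcesFarMerging
  (cc4_axisRefl cc2_axisRefl cc4_swap measurable_covProd isingExpect_covProd)

/-! ### The mirrors `θ_t : y₀ ↦ t - y₀` -/

/-- First coordinate of the mirror image: `(θ_k y)₀ = k - y₀`. [folklore] -/
theorem axisRefl_apply_zero (k : ℤ) (y : Site 3) : (axisRefl 0 k y) 0 = k - y 0 := by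
  rw [axisRefl_apply, if_pos rfl]

/-- The other coordinates are unchanged by the mirror: `(θ_k y)ⱼ = yⱼ` for `j ≠ 0`. [folklore] -/
theorem axisRefl_apply_ne (k : ℤ) (y : Site 3) {j : Fin 3} (hj : j ≠ 0) : (axisRefl 0 k y) j = y j := by
  rw [axisRefl_apply, if_neg hj]

/-- `θ_t 0 = t e₁`. [folklore] -/
theorem axisRefl_nat_zero (t : ℕ) : axisRefl 0 (t : ℤ) (0 : Site 3) = (t : ℤ) • e₁ := by
  ext j
  fin_cases j <;> simp [axisRefl_apply, e₁]

/-- `θ_t e₂ = t e₁ + e₂`. [folklore] -/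
theorem axisRefl_nat_e₂ (t : ℕ) : axisRefl 0 (t : ℤ) (e₂ : Site 3) = (t : ℤ) • e₁ + e₂ := by
  ext j
  fin_cases j <;> simp [axisRefl_apply, e₁, e₂]

/-- `θ_t` moves the boxes by at most `t`: `θ_t Λ(L) ⊆ Λ(L + t)`. [folklore] -/
theorem axisRefl_nat_mem_box (t L : ℕ) (y : Site 3) (hy : y ∈ box 3 L) :
    axisRefl 0 (t : ℤ) y ∈ box 3 (L + (t : ℤ).natAbs) :=
  axisRefl_mem_box 0 (t : ℤ) L y hy

/-! ### The critical state along the `θ`-symmetrised boxes -/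

/-- **Free expectations of spin monomials along the symmetrised boxes `Λ(L) ∪ θΛ(L)` converge to the
critical correlators** whenever `θ` moves boxes boundedly: the free correlations are nondecreasing in
the volume (Griffiths; Friedli–Velenik 2017, Exercise 3.12), so the symmetrised boxes are sandwiched
between `Λ(L)` and `Λ(L + R)`, along both of which the free expectations tend to the critical state
(`criticalCorr_wellDefined_holds`). [cite: FriedliVelenik2017, Exercise 3.12, p. 112] -/
theorem tendsto_spinMonomial_symBox {θ : Site 3 ≃ Site 3} {R : ℕ}
    (hR : ∀ L, ∀ y ∈ box 3 L, θ y ∈ box 3 (L + R)) {n : ℕ} (x : Fin n → Site 3) :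
    Tendsto (fun L : ℕ => isingExpect (zdGraph 3) (symBox θ L) (criticalBeta 3) 0 .free (spinMonomial x))
      atTop (𝓝 (criticalCorr 3 n x)) := by
  classical
  have hg : Tendsto (fun L : ℕ => isingExpect (zdGraph 3) (box 3 L) (criticalBeta 3) 0 .free
      (spinMonomial x)) atTop (𝓝 (criticalCorr 3 n x)) :=
    criticalCorr_wellDefined_holds (d := 3) le_rfl n x .free (by simp)
  obtain ⟨A, hA⟩ := exists_spinMonomial_eq_spinProduct x
  rw [hA] at hg ⊢
  have hf : Tendsto (fun L : ℕ => isingExpect (zdGraph 3) (box 3 (L + R)) (criticalBeta 3) 0 .free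
      (spinProduct A)) atTop (𝓝 (criticalCorr 3 n x)) :=
    (Filter.tendsto_add_atTop_iff_nat R).2 hg
  obtain ⟨L₀, hL₀⟩ := exists_forall_subset_box 3 A
  have hβ : 0 ≤ criticalBeta 3 := criticalBeta_nonneg 3
  refine tendsto_of_tendsto_of_tendsto_of_le_of_le' hg hf ?_ ?_
  · filter_upwards [eventually_ge_atTop L₀] with L hL
    exact isingCorr_free_le_of_subset (zdGraph 3) hβ le_rfl (hL₀ L hL) (box_subset_symBox θ L)
  · filter_upwards [eventually_ge_atTop L₀] with L hL
    exact isingCorr_free_le_of_subset (zdGraph 3) hβ le_rfl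
      ((hL₀ L hL).trans (box_subset_symBox θ L)) (symBox_subset_box hR L)

/-- **Symmetrised-box limit** of `⟨(σ_uσ_v - α)(σ_wσ_x - γ)⟩^∅_{Λ(L) ∪ θΛ(L); β_c}` (linearity and
`tendsto_spinMonomial_symBox`). [cite: FriedliVelenik2017, Exercise 3.12, p. 112] -/
theorem tendsto_covProd_symBox {θ : Site 3 ≃ Site 3} {R : ℕ}
    (hR : ∀ L, ∀ y ∈ box 3 L, θ y ∈ box 3 (L + R)) (u v w x : Site 3) (α γ : ℝ) :
    Tendsto (fun L : ℕ => isingExpect (zdGraph 3) (symBox θ L) (criticalBeta 3) 0 .free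
        (fun σ => (spinAt u σ * spinAt v σ - α) * (spinAt w σ * spinAt x σ - γ))) atTop
      (𝓝 (criticalCorr 3 4 ![u, v, w, x] - γ * criticalCorr 3 2 ![u, v] -
        α * criticalCorr 3 2 ![w, x] + α * γ)) := by
  simp only [isingExpect_covProd]
  exact (((tendsto_spinMonomial_symBox hR ![u, v, w, x]).sub
    ((tendsto_spinMonomial_symBox hR ![u, v]).const_mul γ)).sub
    ((tendsto_spinMonomial_symBox hR ![w, x]).const_mul α)).add_const (α * γ)

/-! ### Reflection positivity of the free critical measure on the symmetrised boxes -/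

/-- **Reflection positivity across the mirror `θ_t` of the free critical measures of the
`θ_t`-symmetrised boxes** (FILS 1978 §2 / Friedli–Velenik Lemma 10.8: through the site plane
`{y₀ = t/2}` for even `t`, the tree's `isingExpect_free_reflect_mul_self_nonneg`; through the bond
plane for odd `t`, the tree's `isingExpect_free_reflect_mul_self_nonneg_of_cross`, ferromagnetic
coupling `β_c ≥ 0`): for every bounded measurable `F` depending only on the spins in `{2y₀ ≤ t}`,
`0 ≤ ⟨(F ∘ θ_t*) F⟩^∅_{Λ(L) ∪ θ_tΛ(L); β_c, 0}`. [cite: FILS1978, Thm. 2.1] -/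
theorem rp_symBox_nonneg (t L : ℕ) {F : SpinConfig (Site 3) → ℝ} (hFm : Measurable F)
    (hFP : DependsOn F {w : Site 3 | 2 * w 0 ≤ (t : ℤ)}) (hFb : ∃ C, ∀ σ, |F σ| ≤ C) :
    0 ≤ isingExpect (zdGraph 3) (symBox (axisRefl 0 (t : ℤ)) L) (criticalBeta 3) 0 .free
      (fun τ => F (configReflect (axisRefl 0 (t : ℤ)) τ) * F τ) := by
  have hθ : Function.Involutive (axisRefl (d := 3) 0 (t : ℤ)) := axisRefl_involutive 0 (t : ℤ)
  have hθG : ∀ x y : Site 3, (zdGraph 3).Adj x y →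
      (zdGraph 3).Adj (axisRefl 0 (t : ℤ) x) (axisRefl 0 (t : ℤ) y) :=
    fun x y h => (zdGraph_adj_axisRefl 0 (t : ℤ) x y).2 h
  have hΛ : ∀ x : Site 3, x ∈ symBox (axisRefl 0 (t : ℤ)) L ↔
      axisRefl 0 (t : ℤ) x ∈ symBox (axisRefl 0 (t : ℤ)) L :=
    fun x => mem_symBox_iff hθ x
  rcases Nat.even_or_odd t with ⟨m, hm⟩ | ⟨m, hm⟩
  · -- even `t = 2m`: reflection through the site plane `{y₀ = m}`
    refine isingExpect_free_reflect_mul_self_nonneg (zdGraph 3) (axisRefl 0 (t : ℤ)) hθ hθG hΛ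
      (P := {w : Site 3 | 2 * w 0 ≤ (t : ℤ)}) (fun x => ?_) (fun x hx hθx => ?_) (fun x y hxy => ?_)
      _ _ hFm hFP hFb
    · simp only [Set.mem_setOf_eq, axisRefl_apply_zero]
      omega
    · simp only [Set.mem_setOf_eq, axisRefl_apply_zero] at hx hθx
      funext j
      by_cases hj : j = 0
      · subst hj
        rw [axisRefl_apply_zero]
        omega
      · exact axisRefl_apply_ne _ x hj
    · obtain ⟨l, hl, hrest⟩ := zdGraph_adj_coord hxy
      simp only [Set.mem_setOf_eq, axisRefl_apply_zero]
      by_cases hl0 : (0 : Fin 3) = l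
      · subst hl0
        omega
      · have h0 := hrest 0 hl0
        omega
  · -- odd `t = 2m + 1`: reflection through the bond plane `{y₀ = m + 1/2}`
    refine isingExpect_free_reflect_mul_self_nonneg_of_cross (zdGraph 3) (axisRefl 0 (t : ℤ)) hθ hθG
      hΛ (P := {w : Site 3 | 2 * w 0 ≤ (t : ℤ)}) (fun x => ?_) (fun x y hxy hx hy => ?_)
      (criticalBeta_nonneg 3) _ hFm hFP hFb
    · simp only [Set.mem_setOf_eq, axisRefl_apply_zero, not_le]
      omega
    · simp only [Set.mem_setOf_eq, not_le] at hx hy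
      obtain ⟨l, hl, hrest⟩ := zdGraph_adj_coord hxy
      funext j
      by_cases hj : j = 0
      · subst hj
        rw [axisRefl_apply_zero]
        by_cases hl0 : (0 : Fin 3) = l
        · subst hl0
          omega
        · have h0 := hrest 0 hl0
          omega
      · rw [axisRefl_apply_ne _ x hj]
        by_cases hjl : j = l
        · subst hjl
          have h0 := hrest 0 (Ne.symm hj)
          omega
        · exact hrest j hjl

/-! ### The Gram inequality across the mirror `θ_t` -/

/-- **The RP quadratic form is nonnegative.** For sites `a, b, p, q` in the half `{2y₀ ≤ t}`, the
limit `L → ∞` of `0 ≤ ⟨(F_s ∘ θ_t*) F_s⟩^∅_{Λ(L) ∪ θ_tΛ(L); β_c}`,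
`F_s = (σ_aσ_b - α) + s (σ_pσ_q - γ)`, written out as a quadratic polynomial in `s` with
critical-correlator coefficients. [cite: FILS1978, Thm. 2.1] -/
theorem rp_quadratic_mirror_nonneg (t : ℕ) (a b p q : Site 3) (ha : 2 * a 0 ≤ (t : ℤ))
    (hb : 2 * b 0 ≤ (t : ℤ)) (hp : 2 * p 0 ≤ (t : ℤ)) (hq : 2 * q 0 ≤ (t : ℤ)) (α γ s : ℝ) :
    0 ≤ (criticalCorr 3 4 ![axisRefl 0 (t : ℤ) a, axisRefl 0 (t : ℤ) b, a, b] -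
            α * criticalCorr 3 2 ![axisRefl 0 (t : ℤ) a, axisRefl 0 (t : ℤ) b] -
            α * criticalCorr 3 2 ![a, b] + α * α) +
      (s * ((criticalCorr 3 4 ![axisRefl 0 (t : ℤ) a, axisRefl 0 (t : ℤ) b, p, q] -
                γ * criticalCorr 3 2 ![axisRefl 0 (t : ℤ) a, axisRefl 0 (t : ℤ) b] -
                α * criticalCorr 3 2 ![p, q] + α * γ) +
            (criticalCorr 3 4 ![axisRefl 0 (t : ℤ) p, axisRefl 0 (t : ℤ) q, a, b] -
              α * criticalCorr 3 2 ![axisRefl 0 (t : ℤ) p, axisRefl 0 (t : ℤ) q] -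
              γ * criticalCorr 3 2 ![a, b] + γ * α)) +
        s ^ 2 * (criticalCorr 3 4 ![axisRefl 0 (t : ℤ) p, axisRefl 0 (t : ℤ) q, p, q] -
          γ * criticalCorr 3 2 ![axisRefl 0 (t : ℤ) p, axisRefl 0 (t : ℤ) q] -
          γ * criticalCorr 3 2 ![p, q] + γ * γ)) := by
  set θ : Site 3 ≃ Site 3 := axisRefl 0 (t : ℤ) with hθdef
  have hR : ∀ L, ∀ y ∈ box 3 L, θ y ∈ box 3 (L + (t : ℤ).natAbs) := fun L y hy =>
    axisRefl_nat_mem_box t L y hy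
  -- the test observable, local in the half `{2y₀ ≤ t}`
  set F : SpinConfig (Site 3) → ℝ := fun σ =>
    (spinAt a σ * spinAt b σ - α) + s * (spinAt p σ * spinAt q σ - γ) with hF
  have hFm : Measurable F := by
    rw [hF]
    fun_prop
  have hFP : DependsOn F {w : Site 3 | 2 * w 0 ≤ (t : ℤ)} := by
    intro σ τ hστ
    have h1 := hστ a ha
    have h2 := hστ b hb
    have h3 := hστ p hp
    have h4 := hστ q hq
    simp only [hF, spinAt, h1, h2, h3, h4]
  have hFb : ∃ C, ∀ σ, |F σ| ≤ C := by
    refine ⟨(1 + |α|) + |s| * (1 + |γ|), fun σ => ?_⟩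
    have e1 : |spinAt a σ * spinAt b σ - α| ≤ 1 + |α| := by
      refine (abs_sub _ _).trans ?_
      rw [abs_mul, abs_spinAt, abs_spinAt, one_mul]
    have e2 : |spinAt p σ * spinAt q σ - γ| ≤ 1 + |γ| := by
      refine (abs_sub _ _).trans ?_
      rw [abs_mul, abs_spinAt, abs_spinAt, one_mul]
    calc |F σ| ≤ |spinAt a σ * spinAt b σ - α| + |s * (spinAt p σ * spinAt q σ - γ)| :=
          abs_add_le _ _
      _ ≤ (1 + |α|) + |s| * (1 + |γ|) := by
          rw [abs_mul]
          gcongr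
  -- pointwise expansion of `(F ∘ θ*) · F`
  have hpt : (fun τ => F (configReflect θ τ) * F τ) = fun τ =>
      (spinAt (θ a) τ * spinAt (θ b) τ - α) * (spinAt a τ * spinAt b τ - α) +
        (s * ((spinAt (θ a) τ * spinAt (θ b) τ - α) * (spinAt p τ * spinAt q τ - γ) +
              (spinAt (θ p) τ * spinAt (θ q) τ - γ) * (spinAt a τ * spinAt b τ - α)) +
          s ^ 2 * ((spinAt (θ p) τ * spinAt (θ q) τ - γ) * (spinAt p τ * spinAt q τ - γ))) := by
    funext τ
    have h1 : ∀ x : Site 3, spinAt x (configReflect θ τ) = spinAt (θ x) τ := fun x => rfl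
    simp only [hF, h1]
    ring
  -- linearity of the finite-volume expectations
  have hexp : ∀ L : ℕ, isingExpect (zdGraph 3) (symBox θ L) (criticalBeta 3) 0 .free
      (fun τ => F (configReflect θ τ) * F τ) =
      isingExpect (zdGraph 3) (symBox θ L) (criticalBeta 3) 0 .free
          (fun τ => (spinAt (θ a) τ * spinAt (θ b) τ - α) * (spinAt a τ * spinAt b τ - α)) +
        (s * (isingExpect (zdGraph 3) (symBox θ L) (criticalBeta 3) 0 .free
                (fun τ => (spinAt (θ a) τ * spinAt (θ b) τ - α) * (spinAt p τ * spinAt q τ - γ)) +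
              isingExpect (zdGraph 3) (symBox θ L) (criticalBeta 3) 0 .free
                (fun τ => (spinAt (θ p) τ * spinAt (θ q) τ - γ) * (spinAt a τ * spinAt b τ - α))) +
          s ^ 2 * isingExpect (zdGraph 3) (symBox θ L) (criticalBeta 3) 0 .free
            (fun τ => (spinAt (θ p) τ * spinAt (θ q) τ - γ) * (spinAt p τ * spinAt q τ - γ))) := by
    intro L
    have mff := measurable_covProd (θ a) (θ b) a b α α
    have mfg := measurable_covProd (θ a) (θ b) p q α γ
    have mgf := measurable_covProd (θ p) (θ q) a b γ α
    have mgg := measurable_covProd (θ p) (θ q) p q γ γ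
    rw [hpt, isingExpect_add' _ _ _ _ _ mff (((mfg.fun_add mgf).const_mul s).fun_add (mgg.const_mul (s ^ 2))),
      isingExpect_add' _ _ _ _ _ ((mfg.fun_add mgf).const_mul s) (mgg.const_mul (s ^ 2)),
      isingExpect_const_mul' _ _ _ _ _ _ (mfg.fun_add mgf), isingExpect_add' _ _ _ _ _ mfg mgf,
      isingExpect_const_mul' _ _ _ _ _ _ mgg]
  -- the limit `L → ∞` along the symmetrised boxes
  have hlim : Tendsto (fun L : ℕ => isingExpect (zdGraph 3) (symBox θ L) (criticalBeta 3) 0 .free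
      (fun τ => F (configReflect θ τ) * F τ)) atTop
      (𝓝 ((criticalCorr 3 4 ![θ a, θ b, a, b] - α * criticalCorr 3 2 ![θ a, θ b] -
          α * criticalCorr 3 2 ![a, b] + α * α) +
        (s * ((criticalCorr 3 4 ![θ a, θ b, p, q] - γ * criticalCorr 3 2 ![θ a, θ b] -
                α * criticalCorr 3 2 ![p, q] + α * γ) +
              (criticalCorr 3 4 ![θ p, θ q, a, b] - α * criticalCorr 3 2 ![θ p, θ q] -
                γ * criticalCorr 3 2 ![a, b] + γ * α)) +
          s ^ 2 * (criticalCorr 3 4 ![θ p, θ q, p, q] - γ * criticalCorr 3 2 ![θ p, θ q] -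
            γ * criticalCorr 3 2 ![p, q] + γ * γ)))) := by
    simp only [hexp]
    exact (tendsto_covProd_symBox hR (θ a) (θ b) a b α α).add
      ((((tendsto_covProd_symBox hR (θ a) (θ b) p q α γ).add
        (tendsto_covProd_symBox hR (θ p) (θ q) a b γ α)).const_mul s).add
        ((tendsto_covProd_symBox hR (θ p) (θ q) p q γ γ).const_mul (s ^ 2)))
  exact ge_of_tendsto' hlim fun L => rp_symBox_nonneg t L hFm hFP hFb

/-- **The Gram (Cauchy–Schwarz) minor of reflection positivity across `θ_t`**: for `a, b, p, q` in
the half `{2y₀ ≤ t}`,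
`⟨σ_{θa}σ_{θb} ; σ_pσ_q⟩² ≤ ⟨σ_{θa}σ_{θb} ; σ_aσ_b⟩ · ⟨σ_{θp}σ_{θq} ; σ_pσ_q⟩`
(discriminant of the nonnegative RP quadratic form, using `⟨σ_{θa}σ_{θb}⟩ = ⟨σ_aσ_b⟩`). [cite: FILS1978, Thm. 2.1] -/
theorem rp_gram_mirror (t : ℕ) (a b p q : Site 3) (ha : 2 * a 0 ≤ (t : ℤ)) (hb : 2 * b 0 ≤ (t : ℤ))
    (hp : 2 * p 0 ≤ (t : ℤ)) (hq : 2 * q 0 ≤ (t : ℤ)) :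
    (criticalCorr 3 4 ![axisRefl 0 (t : ℤ) a, axisRefl 0 (t : ℤ) b, p, q] -
        criticalCorr 3 2 ![a, b] * criticalCorr 3 2 ![p, q]) ^ 2 ≤
      (criticalCorr 3 4 ![axisRefl 0 (t : ℤ) a, axisRefl 0 (t : ℤ) b, a, b] -
          criticalCorr 3 2 ![a, b] * criticalCorr 3 2 ![a, b]) *
        (criticalCorr 3 4 ![axisRefl 0 (t : ℤ) p, axisRefl 0 (t : ℤ) q, p, q] -
          criticalCorr 3 2 ![p, q] * criticalCorr 3 2 ![p, q]) := by
  have hθθ : ∀ x : Site 3, axisRefl 0 (t : ℤ) (axisRefl 0 (t : ℤ) x) = x := axisRefl_involutive 0 (t : ℤ)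
  have e2 : criticalCorr 3 2 ![axisRefl 0 (t : ℤ) a, axisRefl 0 (t : ℤ) b] = criticalCorr 3 2 ![a, b] :=
    cc2_axisRefl (t : ℤ) a b
  have e3 : criticalCorr 3 2 ![axisRefl 0 (t : ℤ) p, axisRefl 0 (t : ℤ) q] = criticalCorr 3 2 ![p, q] :=
    cc2_axisRefl (t : ℤ) p q
  have e4 : criticalCorr 3 4 ![axisRefl 0 (t : ℤ) p, axisRefl 0 (t : ℤ) q, a, b] =
      criticalCorr 3 4 ![axisRefl 0 (t : ℤ) a, axisRefl 0 (t : ℤ) b, p, q] := by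
    rw [cc4_swap a b (axisRefl 0 (t : ℤ) p) (axisRefl 0 (t : ℤ) q),
      ← cc4_axisRefl (t : ℤ) a b (axisRefl 0 (t : ℤ) p) (axisRefl 0 (t : ℤ) q), hθθ, hθθ]
  set S := criticalCorr 3 4 ![axisRefl 0 (t : ℤ) a, axisRefl 0 (t : ℤ) b, p, q]
  set α := criticalCorr 3 2 ![a, b]
  set γ := criticalCorr 3 2 ![p, q]
  set A := criticalCorr 3 4 ![axisRefl 0 (t : ℤ) a, axisRefl 0 (t : ℤ) b, a, b]
  set C := criticalCorr 3 4 ![axisRefl 0 (t : ℤ) p, axisRefl 0 (t : ℤ) q, p, q]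
  have hquad : ∀ x : ℝ, 0 ≤ (C - γ * γ) * (x * x) + 2 * (S - α * γ) * x + (A - α * α) := by
    intro x
    have hx := rp_quadratic_mirror_nonneg t a b p q ha hb hp hq α γ x
    rw [e2, e3, e4] at hx
    linarith
  have hd := discrim_le_zero hquad
  rw [discrim] at hd
  nlinarith [hd]

/-! ### The stub -/

/-- **Stub A — `RPSchwarzOnePinch`.** The `2 × 2` Gram minor (energy row × pair row) of reflection
positivity of the critical `ℤ³` Ising state across every lattice mirror `θ_t : y₀ ↦ t - y₀`, `t ≥ 1`
(site planes for even `t`, bond planes for odd `t`): for all `p, q` with `2p₀ ≤ t`, `2q₀ ≤ t`,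
`⟨σ₀σ_{e₂} ; σ_{θp}σ_{θq}⟩² ≤ ⟨σ₀σ_{e₂} ; σ_{te₁}σ_{te₁+e₂}⟩ · ⟨σ_pσ_q ; σ_{θp}σ_{θq}⟩`
(`rp_gram_mirror` with the energy row `(a, b) = (0, e₂)`, `θ_t 0 = te₁`, `θ_t e₂ = te₁ + e₂`, and
reflection invariance of the critical correlators). [cite: FILS1978, Thm. 2.1] -/
theorem stub_rpSchwarzOnePinch : RPSchwarzOnePinch := by
  intro t _ p q hp hq
  have hθθ : ∀ x : Site 3, axisRefl 0 (t : ℤ) (axisRefl 0 (t : ℤ) x) = x := axisRefl_involutive 0 (t : ℤ)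
  have h0 : 2 * (0 : Site 3) 0 ≤ (t : ℤ) := by simp
  have he : 2 * (e₂ : Site 3) 0 ≤ (t : ℤ) := by simp [e₂]
  have key := rp_gram_mirror t 0 e₂ p q h0 he hp hq
  have e1 : criticalCorr 3 4 ![0, e₂, axisRefl 0 (t : ℤ) p, axisRefl 0 (t : ℤ) q] =
      criticalCorr 3 4 ![axisRefl 0 (t : ℤ) 0, axisRefl 0 (t : ℤ) e₂, p, q] := by
    rw [← cc4_axisRefl (t : ℤ) (axisRefl 0 (t : ℤ) 0) (axisRefl 0 (t : ℤ) e₂) p q, hθθ, hθθ]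
  simp only [pairTrunc]
  rw [← axisRefl_nat_e₂ t, ← axisRefl_nat_zero t, e1,
    cc4_swap (axisRefl 0 (t : ℤ) 0) (axisRefl 0 (t : ℤ) e₂) 0 e₂,
    cc4_swap (axisRefl 0 (t : ℤ) p) (axisRefl 0 (t : ℤ) q) p q, cc2_axisRefl (t : ℤ) 0 e₂,
    cc2_axisRefl (t : ℤ) p q]
  exact key

end Summit.CriticalPhenomena.Ising3DConformalLimit.GapForcesFarMergingRPSchwarz

end
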